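import Literature.MathematicalPhysics.QuantumFieldTheory.Balaban1983to89.B2Eq230CondShiftBound

/-!
# `Balaban1983to89.B1Ineq358TreeDecaySum` — T. Bałaban, *(Higgs)₂,₃ quantum fields in a finite volume. I. A lower bound*,
Commun. Math. Phys. **85** (1982) 603–626 [Balaban1982Higgs1]: the SUMMATION behind the sentence of p. 625 [PDF 23] following (3.66)
— *"Using representation (3.57) in Proposition 3.2 and the restrictions on the fields A, φ we can estimate the absolute value of the
interaction V^{(K)ε} by O(1)(L^Kε)^{κ₀}|T₁^{(K)}|"* — PROVED on the model's tori `T^{(k)}` (`HiggsLattice.Site P k`, distance (1.3) in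
lattice units `HiggsLattice.Site.tdist`): a polynomial of the printed shape (3.57) whose kernels obey the tree-decay bound (3.58) and whose
field arguments are bounded pointwise is bounded by `O(1)·|T^{(k)}|`, with every constant explicit

statement-level skeleton of published theorems with citation tags; proofs where landed; nothing here is a claim about the Yang–Mills mass gap

PDF held: `paper:balaban1982-cmp85-higgs23-i` (journal page = PDF page + 602); p. 622 [PDF 20] (Prop. 3.2, (3.57)–(3.58)) and p. 625 [PDF 23]
READ AS IMAGES on the ×2 renders `run/shared/lean/pub/pub-balaban/b2b-balaban-ref1/pages/1982-cmp85-higgs23-I/1982-cmp85-higgs23-I-p020-x2.png`,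
`…-p022-x2.png`, `…-p023-x2.png` (the OCR text `~/.lit/texts/paper-balaban1982-cmp85-higgs23-i/p0020.txt` is garbled at the displays).

CITATION HEADER (lean-in-tree rule).  Cell `lit-balaban` (HOME `run/shared/lean/pub/lit-balaban/`), Phase-2 proof seat **p14** gen 12 (unit
`lit-balaban-p14`; TAKING line HOME/STATUS.md 2026-08-21T22:39Z), file 1 of 3.  SKELETON rows **B1.Prop3.2** (owner r01/r12; typed carrier-abstract by
r14 as `B1LowerBound.Prop32Printed`) and **B1.Eq3.66–3.67** (owner r12; the p. 625 sentence above is the input `hE2` — *"|V^{(K),ε}| ≦ C₂|T_ε|"* — of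
the model's ledger of (1.14), `B1LowerBound114Model.Inputs` / `B1Eq369Model.PreInputs369`).  THIS FILE is the lattice-geometric half of that
sentence; file 2 (`B1Ineq352LevelK`) is *"the restrictions on the fields A, φ"*, file 3 (`B1Prop32InteractionBound`) assembles them at the model
and discharges `hE2`.  USED BY NAME, never restated: `B2Eq230CondShiftBound.sum_exp_neg_tdist_le` (the one-point torus sum
`Σ_y e^{−δ|x−y|} ≦ K_d(δ)`, every torus of the model) with its constant `B4Sect5Proof.latticeConst`.

WHAT IS PRINTED (verbatim, p. 622 [PDF 20]).  *"**Proposition 3.2.** The function V^{(k)}(B^{(k+1)},ψ,A′^{(k)},φ′) has the form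
V^{(k)}(B^{(k+1)},ψ,A′^{(k)},φ′) = Σ_{n,m=0}^{n(n̄)} Σ_{x₁,…,x_n,y₁,…,y_m∈T₁^{(k)}} Σ_{j₁,…,j_n=1}^{N} Σ_{μ₁,…,μ_m=1}^{d}
v^{(k)}_{j₁,…,j_n;μ₁,…,μ_m}(B^{(k+1)},ψ;x₁,…,x_n,y₁,…,y_m) φ′_{j₁}(x₁)…φ′_{j_n}(x_n) A′_{μ₁}(y₁)…A′_{μ_m}(y_m), (3.57) and the coefficients
in the above representation satisfy the inequalities |v^{(k)}_{j₁,…,j_n;μ₁,…,μ_m}(B^{(k+1)},ψ;x₁,…,x_n,y₁,…,y_m)| ≦ O(1)(L^kε)^{κ₀}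
exp(−δ₀d(x₁,…,x_n,y₁,…,y_m)) (3.58) for some independent of k positive constants κ₀, δ₀, and O(1), where d(x₁,…,x_n,y₁,…,y_m) denotes
a length of the shortest graph connecting the points x₁,…,x_n,y₁,…,y_m."*  p. 625 [PDF 23]: the sentence quoted in the title.

THE ARGUMENT (the print leaves it to the reader; standard).  A graph connecting the points `z₁,…,z_q` contains a path between any two of
them, so its length dominates every pairwise distance: `d(z₁,…,z_q) ≧ diam(z) := max_{i,j}|z_i − z_j| ≧ |z₁ − z_i|` for every `i`.  Hence
`δ₀d(z) ≧ (δ₀/(q−1))Σ_{i=2}^{q}|z₁ − z_i|`, `e^{−δ₀d(z)} ≦ Π_{i=2}^{q}e^{−(δ₀/(q−1))|z₁−z_i|}`, and summing the `q − 1` points `z₂,…,z_q`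
independently over the torus (`Σ_y e^{−δ|x−y|} ≦ K_d(δ)` uniformly in `x` and in the torus) gives
`Σ_{z₁,…,z_q∈T} e^{−δ₀d(z)} ≦ |T|·K_d(δ₀/(q−1))^{q−1}`.  With `|φ′_j(x)|, |A′_μ(y)| ≦ q₀` (*"the restrictions on the fields"*) and at most
`(N + d)^q` index patterns per point tuple, `|V| ≦ O(1)(L^kε)^{κ₀}·|T₁^{(k)}|·Σ_{q≦2n(n̄)}((N+d)q₀)^q K_d(δ₀/(q−1))^{q−1}`.

WHAT THIS FILE PROVES (kernel-checked, zero `sorry`; axioms standard).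
* §1 `diam` (the diameter `max_{i,j}|z_i − z_j|` of a point tuple `z : Fin q → T^{(k)}` in the distance (1.3), lattice units), `tdist_le_diam`,
  `exp_neg_diam_le_prod` (`e^{−δ·diam z} ≦ Π_{i<r} e^{−(δ/r)|z₀ − z_{i+1}|}`, `q = r + 1`), `treeConst` (`K_d(δ/r)^r`, and `1` for `q = 0`),
  **`sum_exp_neg_diam_le`** (`Σ_{z : Fin (r+1) → T^{(k)}} e^{−δ·diam z} ≦ |T^{(k)}|·K_d(δ/r)^r`) and `sum_exp_neg_diam_le_treeConst` (every `q`).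
* §2 `poly357` — a polynomial of the shape (3.57), RE-INDEXED BY TOTAL DEGREE: `Σ_{q≦qmax} Σ_{z : Fin q → T^{(k)}} Σ_{κ : Fin q → Λ}
  c(q; z; κ)·Π_i leg(κ_i, z_i)` over a finite LEG-LABEL type `Λ` (at the model `Λ = {1,…,N} ⊔ {1,…,d}`: a scalar component `φ′_j` or a vector
  component `A′_μ`; the printed double sum over `(n, m)` with the `x`'s before the `y`'s is the case `q = n + m`, `κ = (j₁,…,j_n; μ₁,…,μ_m)`),
  `abs_prod_leg_le` (`|Π_i leg| ≦ q₀^q`), `polyConst`, and **`abs_poly357_le`**: if `|c(q; z; κ)| ≦ A₀e^{−δ₀·diam z}` (the bound (3.58) with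
  `A₀ = O(1)(L^kε)^{κ₀}` and the diameter in place of `d(…)` — WEAKER than printed, as `d ≧ diam`) and `|leg(l, x)| ≦ q₀`, then
  `|poly357| ≦ A₀·|T^{(k)}|·polyConst`, `polyConst = Σ_{q≦qmax}(|Λ|q₀)^q·treeConst_q` — the p. 625 sentence with its `O(1)` explicit.
HONEST SCOPE.  Pure lattice combinatorics on the model's tori; nothing about the kernels `v^{(k)}` themselves (Prop. 3.2 is proved in paper III,
not here — file 3 displays (3.57)/(3.58) at `k = K` as the hypothesis it is in paper I); the Steiner length `d(…)` of the print is not formalised —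
only its consequence `d ≧ diam` is used, so the hypothesis of `abs_poly357_le` is implied by (3.58) as printed.  Nothing here is summit progress.
-/

open scoped BigOperators

namespace Literature.MathematicalPhysics.QuantumFieldTheory.Balaban1983to89.B1Ineq358TreeDecaySum

open Literature.MathematicalPhysics.QuantumFieldTheory.Balaban1983to89.B2Eq230CondShiftBound (sum_exp_neg_tdist_le)
open Literature.MathematicalPhysics.QuantumFieldTheory.Balaban1983to89.B4Sect5Proof (latticeConst latticeConst_nonneg)

variable {P : HiggsLattice.Params} {k : ℕ}

/-! ## §1 The diameter of a point tuple on `T^{(k)}` and the tree-decay summation -/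

section Diameter

/-- The DIAMETER `max_{i,j}|z_i − z_j|` (distance (1.3), lattice units of `T^{(k)}`) of a point tuple `z = (z_i)_{i<q}` — a lower
bound of the print's `d(z₁,…,z_q)` = *"a length of the shortest graph connecting the points"* (a connecting graph contains a path
between any two of its points). [cite: Balaban1982Higgs1, Prop. 3.2 (3.58) p.622] -/
def diam {q : ℕ} (z : Fin q → HiggsLattice.Site P k) : ℕ :=
  Finset.univ.sup fun i => Finset.univ.sup fun j => HiggsLattice.Site.tdist (z i) (z j)

/-- Every pairwise distance is at most the diameter. [cite: Balaban1982Higgs1, Prop. 3.2 (3.58) p.622] -/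
theorem tdist_le_diam {q : ℕ} (z : Fin q → HiggsLattice.Site P k) (i j : Fin q) : HiggsLattice.Site.tdist (z i) (z j) ≤ diam z := by
  unfold diam
  exact (Finset.le_sup (f := fun j => HiggsLattice.Site.tdist (z i) (z j)) (Finset.mem_univ j)).trans
    (Finset.le_sup (f := fun i => Finset.univ.sup fun j => HiggsLattice.Site.tdist (z i) (z j)) (Finset.mem_univ i))

/-- **The decay factor splits along the star at the first point**: for `q = r + 1` points and `δ ≧ 0`,
`e^{−δ·diam z} ≦ Π_{i<r} e^{−(δ/r)·|z₀ − z_{i+1}|}` (each `|z₀ − z_{i+1}| ≦ diam z`, so their mean is `≦ diam z`).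
[cite: Balaban1982Higgs1, Prop. 3.2 (3.58) p.622] -/
theorem exp_neg_diam_le_prod {r : ℕ} {δ : ℝ} (hδ : 0 ≤ δ) (z : Fin (r + 1) → HiggsLattice.Site P k) :
    Real.exp (-(δ * (diam z : ℝ))) ≤ ∏ i : Fin r, Real.exp (-(δ / r * (HiggsLattice.Site.tdist (z 0) (z i.succ) : ℝ))) := by
  rw [← Real.exp_sum, Real.exp_le_exp, Finset.sum_neg_distrib, ← Finset.mul_sum, neg_le_neg_iff]
  have hsum : (∑ i : Fin r, (HiggsLattice.Site.tdist (z 0) (z i.succ) : ℝ)) ≤ r * (diam z : ℝ) := by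
    calc (∑ i : Fin r, (HiggsLattice.Site.tdist (z 0) (z i.succ) : ℝ)) ≤ ∑ _i : Fin r, (diam z : ℝ) :=
          Finset.sum_le_sum fun i _ => by exact_mod_cast tdist_le_diam z 0 i.succ
      _ = r * (diam z : ℝ) := by rw [Finset.sum_const, Finset.card_univ, Fintype.card_fin, nsmul_eq_mul]
  have key : δ / r * ∑ i : Fin r, (HiggsLattice.Site.tdist (z 0) (z i.succ) : ℝ) ≤ δ * (diam z : ℝ) := by
    rcases Nat.eq_zero_or_pos r with hr | hr
    · subst hr
      simp only [Finset.univ_eq_empty, Finset.sum_empty, mul_zero]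
      positivity
    · have hr' : (0 : ℝ) < r := by exact_mod_cast hr
      calc δ / r * ∑ i : Fin r, (HiggsLattice.Site.tdist (z 0) (z i.succ) : ℝ) ≤ δ / r * (r * (diam z : ℝ)) :=
            mul_le_mul_of_nonneg_left hsum (div_nonneg hδ hr'.le)
        _ = δ * (diam z : ℝ) := by field_simp
  exact key

/-- The constant of the tree-decay summation for `q` points: `K_d(δ/(q−1))^{q−1}` (`B4Sect5Proof.latticeConst`), and `1` for `q = 0`
(no point: the empty product). [cite: Balaban1982Higgs1, Prop. 3.2 (3.58) p.622] -/
noncomputable def treeConst (d : ℕ) (δ : ℝ) : ℕ → ℝ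
  | 0 => 1
  | r + 1 => latticeConst d (δ / r) ^ r

/-- `treeConst ≧ 0` (`δ ≧ 0`). [cite: Balaban1982Higgs1, Prop. 3.2 (3.58) p.622] -/
theorem treeConst_nonneg (d : ℕ) {δ : ℝ} (hδ : 0 ≤ δ) : ∀ q : ℕ, 0 ≤ treeConst d δ q
  | 0 => zero_le_one
  | r + 1 => pow_nonneg (latticeConst_nonneg d (div_nonneg hδ (Nat.cast_nonneg r))) r

/-- **THE TREE-DECAY SUMMATION on the torus `T^{(k)}`**: for `δ > 0` and `q = r + 1 ≧ 1` points,
`Σ_{z : Fin (r+1) → T^{(k)}} e^{−δ·diam z} ≦ |T^{(k)}|·K_d(δ/r)^r` — sum the first point over the torus and the other `r` independently with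
the one-point bound `Σ_y e^{−(δ/r)|x−y|} ≦ K_d(δ/r)` (`B2Eq230CondShiftBound.sum_exp_neg_tdist_le`, uniform in `x` and in the torus).  Since the
print's `d(z₁,…,z_q) ≧ diam z`, the same bound holds for `Σ e^{−δd(z)}`. [cite: Balaban1982Higgs1, Prop. 3.2 (3.58) p.622; p.625 (after (3.66))] -/
theorem sum_exp_neg_diam_le {r : ℕ} {δ : ℝ} (hδ : 0 < δ) :
    ∑ z : Fin (r + 1) → HiggsLattice.Site P k, Real.exp (-(δ * (diam z : ℝ)))
      ≤ (Fintype.card (HiggsLattice.Site P k) : ℝ) * latticeConst P.d (δ / r) ^ r := by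
  set f : HiggsLattice.Site P k → HiggsLattice.Site P k → ℝ := fun a y => Real.exp (-(δ / r * (HiggsLattice.Site.tdist a y : ℝ))) with hf
  -- termwise: the star bound
  have h1 : ∑ z : Fin (r + 1) → HiggsLattice.Site P k, Real.exp (-(δ * (diam z : ℝ)))
      ≤ ∑ z : Fin (r + 1) → HiggsLattice.Site P k, ∏ i : Fin r, f (z 0) (z i.succ) :=
    Finset.sum_le_sum fun z _ => exp_neg_diam_le_prod hδ.le z
  -- reindex `z = Fin.cons a w`
  have h2 : ∑ z : Fin (r + 1) → HiggsLattice.Site P k, ∏ i : Fin r, f (z 0) (z i.succ)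
      = ∑ a : HiggsLattice.Site P k, ∑ w : Fin r → HiggsLattice.Site P k, ∏ i : Fin r, f a (w i) := by
    rw [← (Fin.consEquiv fun _ : Fin (r + 1) => HiggsLattice.Site P k).sum_comp, Fintype.sum_prod_type]
    refine Finset.sum_congr rfl fun a _ => Finset.sum_congr rfl fun w _ => ?_
    simp only [Fin.consEquiv_apply, Fin.cons_zero, Fin.cons_succ]
  -- the inner sum is a power of the one-point sum
  have h3 : ∀ a : HiggsLattice.Site P k, ∑ w : Fin r → HiggsLattice.Site P k, ∏ i : Fin r, f a (w i) = (∑ y : HiggsLattice.Site P k, f a y) ^ r :=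
    fun a => (Fintype.sum_pow (f a) r).symm
  have h4 : ∀ a : HiggsLattice.Site P k, (∑ y : HiggsLattice.Site P k, f a y) ^ r ≤ latticeConst P.d (δ / r) ^ r := by
    intro a
    rcases Nat.eq_zero_or_pos r with hr | hr
    · subst hr
      simp
    · have hδr : 0 < δ / r := div_pos hδ (by exact_mod_cast hr)
      exact pow_le_pow_left₀ (Finset.sum_nonneg fun y _ => (Real.exp_pos _).le) (sum_exp_neg_tdist_le hδr a) r
  calc ∑ z : Fin (r + 1) → HiggsLattice.Site P k, Real.exp (-(δ * (diam z : ℝ)))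
      ≤ ∑ a : HiggsLattice.Site P k, ∑ w : Fin r → HiggsLattice.Site P k, ∏ i : Fin r, f a (w i) := h1.trans_eq h2
    _ ≤ ∑ _a : HiggsLattice.Site P k, latticeConst P.d (δ / r) ^ r := Finset.sum_le_sum fun a _ => (h3 a).trans_le (h4 a)
    _ = (Fintype.card (HiggsLattice.Site P k) : ℝ) * latticeConst P.d (δ / r) ^ r := by
        rw [Finset.sum_const, Finset.card_univ, nsmul_eq_mul]

/-- The same for every number `q` of points with the constant `treeConst` (`q = 0`: one empty tuple, diameter `0`, and `1 ≦ |T^{(k)}|`).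
[cite: Balaban1982Higgs1, Prop. 3.2 (3.58) p.622; p.625 (after (3.66))] -/
theorem sum_exp_neg_diam_le_treeConst {δ : ℝ} (hδ : 0 < δ) :
    ∀ q : ℕ, ∑ z : Fin q → HiggsLattice.Site P k, Real.exp (-(δ * (diam z : ℝ))) ≤ (Fintype.card (HiggsLattice.Site P k) : ℝ) * treeConst P.d δ q
  | 0 => by
    have hcard : (1 : ℝ) ≤ Fintype.card (HiggsLattice.Site P k) := by exact_mod_cast Fintype.card_pos (α := HiggsLattice.Site P k)
    have hdiam : ∀ z : Fin 0 → HiggsLattice.Site P k, (diam z : ℝ) = 0 := fun z => by simp [diam]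
    simp only [hdiam, mul_zero, neg_zero, Real.exp_zero, Finset.sum_const, Finset.card_univ, mul_one, treeConst]
    have : Fintype.card (Fin 0 → HiggsLattice.Site P k) = 1 := by simp
    rw [this]
    simpa using hcard
  | r + 1 => sum_exp_neg_diam_le hδ

end Diameter

/-! ## §2 A polynomial of the shape (3.57) with kernels obeying (3.58): the bound of p. 625 -/

section Poly

variable {Λ : Type} [Fintype Λ]

/-- **The shape (3.57), re-indexed by total degree**: `Σ_{q≦qmax} Σ_{z : Fin q → T^{(k)}} Σ_{κ : Fin q → Λ} c(q; z; κ)·Π_{i<q} leg(κ_i, z_i)` —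
`leg(l, x)` the value of the field component labelled `l ∈ Λ` at the point `x` (at the model `Λ = {1,…,N} ⊔ {1,…,d}`, `leg(j, x) = φ′_j(x)`,
`leg(μ, y) = A′_μ(y)`), `c(q; z; κ)` the kernel `v^{(k)}_{j;μ}(B^{(k+1)},ψ; x, y)` of the monomial (the printed `(n, m)`-term is the case
`q = n + m`, `z = (x₁,…,x_n,y₁,…,y_m)`, `κ = (j₁,…,j_n;μ₁,…,μ_m)`; other label patterns carry the kernel `0`). [cite: Balaban1982Higgs1, Prop. 3.2 (3.57) p.622] -/
def poly357 (qmax : ℕ) (coef : (q : ℕ) → (Fin q → HiggsLattice.Site P k) → (Fin q → Λ) → ℝ) (leg : Λ → HiggsLattice.Site P k → ℝ) : ℝ :=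
  ∑ q ∈ Finset.range (qmax + 1), ∑ z : Fin q → HiggsLattice.Site P k, ∑ κ : Fin q → Λ, coef q z κ * ∏ i, leg (κ i) (z i)

omit [Fintype Λ] in
/-- *"the restrictions on the fields"*: `|leg| ≦ q₀` pointwise gives `|Π_{i<q} leg(κ_i, z_i)| ≦ q₀^q`. [cite: Balaban1982Higgs1, p.625 (after (3.66))] -/
theorem abs_prod_leg_le {q : ℕ} (leg : Λ → HiggsLattice.Site P k → ℝ) {q₀ : ℝ} (hleg : ∀ l x, |leg l x| ≤ q₀) (z : Fin q → HiggsLattice.Site P k)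
    (κ : Fin q → Λ) : |∏ i, leg (κ i) (z i)| ≤ q₀ ^ q := by
  rw [Finset.abs_prod]
  calc ∏ i, |leg (κ i) (z i)| ≤ ∏ _i : Fin q, q₀ := Finset.prod_le_prod (fun i _ => abs_nonneg _) fun i _ => hleg _ _
    _ = q₀ ^ q := by rw [Finset.prod_const, Finset.card_univ, Fintype.card_fin]

/-- The explicit `O(1)` of the p. 625 sentence (per unit of `O(1)(L^kε)^{κ₀}·|T₁^{(k)}|`): `Σ_{q≦qmax}(|Λ|·q₀)^q·treeConst_q`, depending on
the degree bound, the number of field components, the field bound `q₀`, the dimension and `δ₀` only. [cite: Balaban1982Higgs1, p.625 (after (3.66))] -/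
noncomputable def polyConst (qmax : ℕ) (nΛ q₀ : ℝ) (d : ℕ) (δ₀ : ℝ) : ℝ :=
  ∑ q ∈ Finset.range (qmax + 1), (nΛ * q₀) ^ q * treeConst d δ₀ q

/-- `polyConst ≧ 0` for `nΛ·q₀ ≧ 0`, `δ₀ ≧ 0`. [cite: Balaban1982Higgs1, p.625 (after (3.66))] -/
theorem polyConst_nonneg (qmax : ℕ) {nΛ q₀ : ℝ} (h : 0 ≤ nΛ * q₀) (d : ℕ) {δ₀ : ℝ} (hδ : 0 ≤ δ₀) :
    0 ≤ polyConst qmax nΛ q₀ d δ₀ :=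
  Finset.sum_nonneg fun q _ => mul_nonneg (pow_nonneg h q) (treeConst_nonneg d hδ q)

/-- One degree: `Σ_z Σ_κ |c(q;z;κ)|·|Π leg| ≦ A₀·|T^{(k)}|·(|Λ|q₀)^q·treeConst_q` under the kernel bound `|c| ≦ A₀e^{−δ₀·diam z}` and `|leg| ≦ q₀`.
[cite: Balaban1982Higgs1, Prop. 3.2 (3.58) p.622; p.625 (after (3.66))] -/
theorem sum_abs_term_le (q : ℕ) (coef : (q : ℕ) → (Fin q → HiggsLattice.Site P k) → (Fin q → Λ) → ℝ) (leg : Λ → HiggsLattice.Site P k → ℝ)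
    {A₀ δ₀ q₀ : ℝ} (hA₀ : 0 ≤ A₀) (hδ₀ : 0 < δ₀) (hq₀ : 0 ≤ q₀)
    (hcoef : ∀ (z : Fin q → HiggsLattice.Site P k) (κ : Fin q → Λ), |coef q z κ| ≤ A₀ * Real.exp (-(δ₀ * (diam z : ℝ))))
    (hleg : ∀ l x, |leg l x| ≤ q₀) :
    ∑ z : Fin q → HiggsLattice.Site P k, ∑ κ : Fin q → Λ, |coef q z κ * ∏ i, leg (κ i) (z i)|
      ≤ A₀ * (Fintype.card (HiggsLattice.Site P k) : ℝ) * ((Fintype.card Λ : ℝ) * q₀) ^ q * treeConst P.d δ₀ q := by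
  have hterm : ∀ (z : Fin q → HiggsLattice.Site P k) (κ : Fin q → Λ),
      |coef q z κ * ∏ i, leg (κ i) (z i)| ≤ A₀ * Real.exp (-(δ₀ * (diam z : ℝ))) * q₀ ^ q := by
    intro z κ
    rw [abs_mul]
    exact mul_le_mul (hcoef z κ) (abs_prod_leg_le leg hleg z κ) (abs_nonneg _) (mul_nonneg hA₀ (Real.exp_pos _).le)
  calc ∑ z : Fin q → HiggsLattice.Site P k, ∑ κ : Fin q → Λ, |coef q z κ * ∏ i, leg (κ i) (z i)|
      ≤ ∑ z : Fin q → HiggsLattice.Site P k, ∑ _κ : Fin q → Λ, A₀ * Real.exp (-(δ₀ * (diam z : ℝ))) * q₀ ^ q :=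
        Finset.sum_le_sum fun z _ => Finset.sum_le_sum fun κ _ => hterm z κ
    _ = (A₀ * q₀ ^ q * (Fintype.card Λ : ℝ) ^ q) * ∑ z : Fin q → HiggsLattice.Site P k, Real.exp (-(δ₀ * (diam z : ℝ))) := by
        rw [Finset.mul_sum]
        refine Finset.sum_congr rfl fun z _ => ?_
        rw [Finset.sum_const, Finset.card_univ, Fintype.card_fun, Fintype.card_fin, nsmul_eq_mul]
        push_cast
        ring
    _ ≤ (A₀ * q₀ ^ q * (Fintype.card Λ : ℝ) ^ q) * ((Fintype.card (HiggsLattice.Site P k) : ℝ) * treeConst P.d δ₀ q) :=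
        mul_le_mul_of_nonneg_left (sum_exp_neg_diam_le_treeConst hδ₀ q) (by positivity)
    _ = A₀ * (Fintype.card (HiggsLattice.Site P k) : ℝ) * ((Fintype.card Λ : ℝ) * q₀) ^ q * treeConst P.d δ₀ q := by ring

/-- **THE p. 625 SENTENCE, abstract form** — *"Using representation (3.57) … and the restrictions on the fields … we can estimate the absolute
value of the interaction … by O(1)(L^kε)^{κ₀}|T₁^{(k)}|"*: if the kernels of a polynomial of the shape (3.57) satisfy `|c(q; z; κ)| ≦ A₀e^{−δ₀·diam z}`
(the bound (3.58) with `A₀ = O(1)(L^kε)^{κ₀}`; the diameter replaces the printed length `d ≧ diam` of the shortest connecting graph, a weaker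
hypothesis) and the field components obey `|leg(l, x)| ≦ q₀`, then `|V| ≦ A₀·|T^{(k)}|·polyConst(qmax, |Λ|, q₀, d, δ₀)`.
[cite: Balaban1982Higgs1, p.625 (after (3.66)); Prop. 3.2 (3.57)–(3.58) p.622] -/
theorem abs_poly357_le (qmax : ℕ) (coef : (q : ℕ) → (Fin q → HiggsLattice.Site P k) → (Fin q → Λ) → ℝ) (leg : Λ → HiggsLattice.Site P k → ℝ)
    {A₀ δ₀ q₀ : ℝ} (hA₀ : 0 ≤ A₀) (hδ₀ : 0 < δ₀) (hq₀ : 0 ≤ q₀)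
    (hcoef : ∀ q, q ≤ qmax → ∀ (z : Fin q → HiggsLattice.Site P k) (κ : Fin q → Λ), |coef q z κ| ≤ A₀ * Real.exp (-(δ₀ * (diam z : ℝ))))
    (hleg : ∀ l x, |leg l x| ≤ q₀) :
    |poly357 qmax coef leg| ≤ A₀ * (Fintype.card (HiggsLattice.Site P k) : ℝ) * polyConst qmax (Fintype.card Λ) q₀ P.d δ₀ := by
  unfold poly357 polyConst
  rw [Finset.mul_sum]
  refine (Finset.abs_sum_le_sum_abs _ _).trans (Finset.sum_le_sum fun q hq => ?_)
  have hq' : q ≤ qmax := Nat.lt_succ_iff.mp (Finset.mem_range.mp hq)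
  refine (Finset.abs_sum_le_sum_abs _ _).trans ?_
  refine (Finset.sum_le_sum fun z _ => Finset.abs_sum_le_sum_abs _ _).trans ?_
  have h := sum_abs_term_le q coef leg hA₀ hδ₀ hq₀ (hcoef q hq') hleg
  calc ∑ z : Fin q → HiggsLattice.Site P k, ∑ κ : Fin q → Λ, |coef q z κ * ∏ i, leg (κ i) (z i)|
      ≤ A₀ * (Fintype.card (HiggsLattice.Site P k) : ℝ) * ((Fintype.card Λ : ℝ) * q₀) ^ q * treeConst P.d δ₀ q := h
    _ = A₀ * (Fintype.card (HiggsLattice.Site P k) : ℝ) * (((Fintype.card Λ : ℝ) * q₀) ^ q * treeConst P.d δ₀ q) := by ring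

end Poly

end Literature.MathematicalPhysics.QuantumFieldTheory.Balaban1983to89.B1Ineq358TreeDecaySum
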